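import Literature.Geometry.Kaehler.ComplexTorusCMFieldCentralizerLefschetzLieAlgebraDimension
import HarnessLib

/-!
# The four cases for a simple complex abelian variety of ODD PRIME dimension `p` (`End⁰(X)` is a field, `e ∈ {1, p, 2, 2p}`),
# and Moonen–Zarhin's Thm. (2.7) for every odd prime `p` in the types I(p), IV(p,·) and IV(1) with a multiplicity `≤ 3`

Layer `Literature/Geometry/Kaehler`, namespace `Literature.Geometry.Kaehler.ComplexTorus`; lane `lit-hodgefound` (Track 2
foundations library); prover seat `lit-hodgefound-p17`, generation 58, self-proposed row g58-#10 — the dimension-free form of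
✔ gen-51 `ComplexTorusSimpleAbelianThreefoldFourCases` §1, ✔ gen-56 `ComplexTorusSimpleAbelianFivefoldFourCases` §1 and ✔ g58-#7
`ComplexTorusSimpleAbelianSevenfoldHodgeEqLefschetz` §1 (there by `interval_cases` at `g = 3, 5, 7`; here for every odd prime by
the square-freeness of `2p`), with the case dispatch of MZ99 Thm. (2.7) in the three types the tree settles for EVERY prime.
THEOREMS ONLY (no definition, no instance, no named fact; D-0026 net debt `0`).  `-- TODO(general form):` type I(1) (`End⁰ = ℚ`,
`Hg = Sp_{2p}`: the tree has the ranks `2p ≤ 14` only) and the IV(1) signatures `(n′, n″)` with `min(n′, n″) ≥ 4` (Ribet's Thm. 3 for a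
general coprime pair).

## Sources

* B. Moonen, Yu. Zarhin [MoonenZarhin1999LowDim], Math. Ann. **315** (1999) [corpus: paper:arxiv-math_9901113]: Thm. (2.7) (p0006
  L9–L11) «Let `X` be a simple complex abelian variety such that `dim(X)` is a prime number. Then `Hg(X) = Sp_D(V,φ)` and
  `ℬ•(Xⁿ) = 𝒟•(Xⁿ)` for every `n ≥ 1`.»; (p0006 L2–L8): «if `dim(X)` is a prime number then `End⁰(X)` is commutative … either of
  Type I(1), i.e. `End⁰(X) = ℚ`, or of Type I(g) … or `X` is of CM type, or `End⁰(X)` is an imaginary quadratic field, in which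
  case `A` is of Ribet type»; §1 (p0004 L95–L104): `n_σ + n_σ̄ = 2 dim(X)/[K:ℚ]`.
* B. Gordon [Gordon1997], 1.13.3 («Simple abelian varieties of odd prime dimension … the cases that occur are: `End⁰A ≃ ℚ` …
  totally real of degree `g` … imaginary quadratic … CM-type»), 1.13.2, Thm. 6.3 and Corollary, Thm. 6.4.
* H. Lange [Lange2023AbelianVarietiesComplex], §2.6.1 Proposition (table: `e d² ∣ 2g`, `e ∣ g` for types I–III).
* K. Ribet [Ribet1983], Thms. 0–3; H. Yanai [Yanai1985], §4 Theorem (prime-dimensional simple CM type is nondegenerate).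

## What is proved

* §1 `IsSimple.finrank_centerField_endAlgRat_eq_one_of_prime` (`[End⁰(X) : F] = 1`: `e d² ∣ 2p` and `2p` is square-free),
  `…range_valAlgHom_eq_endAlgRat_of_prime`, `…endAlgRat_comm_of_prime`, `…finrank_centerField_eq_one_or_eq_of_isTotallyReal_of_prime`
  (`e ∈ {1, p}`), `…finrank_centerField_eq_two_or_eq_two_mul_of_prime` (`e ∈ {2, 2p}`), `IsSimple.finrank_centerField_mem_of_prime`
  (the four cases), `IsSimple.isTorusSubgroup_mumfordTateGroupC_of_finrank_centerField_eq_two_mul_of_prime` (IV(p,·) is of CM type),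
  `IsSimple.finrank_iInf_eigenspace_mem_of_finrank_eq_two_of_prime` (`n_σ + n_σ̄ = p`, `1 ≤ n_σ ≤ p − 1`).
* §2 `IsRiemannForm.forall_divisorClasses_powPeriod_eq_hodgeClasses_of_finrank_eq_two_of_prime_of_le_three` (IV(1), some
  multiplicity `≤ 3`), **`IsSimple.forall_divisorClasses_powPeriod_eq_hodgeClasses_of_prime_of_finrank_centerField_ne_one`** (every odd
  prime `p`, every simple `X` of dimension `p` outside type I(1) whose IV(1)-signature — if any — has a part `≤ 3`), the CM ∕ real
  multiplication corollaries and the Hodge-group dimensions `p` (IV(p,·)), `3p` (I(p)), `p²` (IV(1)).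
-/

noncomputable section

open scoped Matrix
open Module Matrix NormedSpace NumberField
open Literature.AlgebraicGeometry.Motives (HodgeTensorFacts hodgeTensorFacts_holds)
open Literature.NumberTheory.Automorphic (IsTorusSubgroup)

namespace Literature.Geometry.Kaehler

namespace ComplexTorus

/-! ## §1 `End⁰(X) = F` for a simple abelian variety of odd prime dimension; `e ∈ {1, p, 2, 2p}`; multiplicities -/

section EndField

variable {κ : Type} [Fintype κ] [DecidableEq κ] [Nonempty κ] {E : Type} [NormedAddCommGroup E] [NormedSpace ℂ E]
  [FiniteDimensional ℂ E] {Ψ : (κ → ℝ) ≃L[ℝ] E} {η : E [⋀^Fin 2]→L[ℝ] ℝ}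

omit [FiniteDimensional ℂ E] in
/-- `ℚ ⊆ F ⊆ End⁰(X)` is a scalar tower. [folklore] -/
private theorem isScalarTower_rat₅₈ (hX : IsSimple Ψ) : IsScalarTower ℚ (centerField Ψ hX) (endAlgRat Ψ) :=
  IsScalarTower.of_algebraMap_smul fun q x ↦ by
    rw [Algebra.smul_def, Algebra.algebraMap_eq_smul_one q,
      map_rat_smul (algebraMap (centerField Ψ hX) (endAlgRat Ψ)) q 1, map_one, smul_mul_assoc, one_mul]

omit [FiniteDimensional ℂ E] in
/-- `End⁰(X)` is a non-trivial ring. [folklore] -/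
private theorem nontrivial_endAlgRat₅₈ (Ψ : (κ → ℝ) ≃L[ℝ] E) : Nontrivial (endAlgRat Ψ) :=
  ⟨⟨0, 1, fun h ↦ zero_ne_one (congrArg Subtype.val h)⟩⟩

/-- **Step I by counting, odd prime `g = p`: `[End⁰(X) : F] = 1`** — `e·d² = [End⁰(X) : ℚ] ∣ 2p` with `[End⁰(X) : F] = d²` and `2p`
square-free forces `d = 1`: `End⁰(X) = F` is commutative («if `dim(X)` is a prime number then `End⁰(X)` is commutative»).
[cite: MoonenZarhin1999LowDim, §2 (p0006 L2–L3)] [cite: Lange2023AbelianVarietiesComplex, §2.6.1 Proposition, proof («`dim_ℚ F = ed²`») and table]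
[cite: Gordon1997, 1.13.3] -/
theorem IsSimple.finrank_centerField_endAlgRat_eq_one_of_prime (hX : IsSimple Ψ) (hp : (finrank ℂ E).Prime)
    (hodd : Odd (finrank ℂ E)) : finrank (centerField Ψ hX) (endAlgRat Ψ) = 1 := by
  obtain ⟨d, hd⟩ := hX.exists_sq_eq_finrank_centerField_endAlgRat
  have hdvd := hX.finrank_centerField_mul_finrank_dvd
  have hsq : Squarefree (2 * finrank ℂ E) :=
    (Nat.squarefree_mul (Nat.coprime_two_left.2 hodd)).2 ⟨Nat.prime_two.squarefree, Irreducible.squarefree hp⟩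
  have hdd : d * d ∣ 2 * finrank ℂ E := by
    rw [← sq, hd]
    exact dvd_trans (Dvd.intro_left _ rfl) hdvd
  have hd1 : d = 1 := Nat.isUnit_iff.1 (hsq d hdd)
  rw [← hd, hd1, one_pow]

/-- **`End⁰(X) = F` for every simple complex abelian variety of odd prime dimension.** [cite: MoonenZarhin1999LowDim, §2 (p0006 L2–L3)] [cite: Gordon1997, 1.13.3] -/
theorem IsSimple.range_valAlgHom_eq_endAlgRat_of_prime (hX : IsSimple Ψ) (hp : (finrank ℂ E).Prime) (hodd : Odd (finrank ℂ E)) :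
    (centerField.valAlgHom Ψ hX).range = endAlgRat Ψ :=
  hX.range_valAlgHom_eq_endAlgRat_of_finrank_eq_one (hX.finrank_centerField_endAlgRat_eq_one_of_prime hp hodd)

/-- **`End⁰(X)` is commutative** for a simple complex abelian variety of odd prime dimension. [cite: MoonenZarhin1999LowDim, §2 (p0006 L2–L3)] [cite: Gordon1997, 1.13.3] -/
theorem IsSimple.endAlgRat_comm_of_prime (hX : IsSimple Ψ) (hp : (finrank ℂ E).Prime) (hodd : Odd (finrank ℂ E)) :
    ∀ a ∈ endAlgRat Ψ, ∀ b ∈ endAlgRat Ψ, a * b = b * a :=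
  hX.endAlgRat_comm_of_finrank_centerField_endAlgRat_eq_one (hX.finrank_centerField_endAlgRat_eq_one_of_prime hp hodd)

/-- **Totally real centre, prime dimension: `e ∈ {1, p}`** (`e ∣ g`; types I(1), I(p)). [cite: Lange2023AbelianVarietiesComplex, §2.6.1 Proposition (table, `e ∣ g`)] [cite: Gordon1997, 1.13.3] -/
theorem IsSimple.finrank_centerField_eq_one_or_eq_of_isTotallyReal_of_prime (hX : IsSimple Ψ) [IsTotallyReal (centerField Ψ hX)]
    (hp : (finrank ℂ E).Prime) : finrank ℚ (centerField Ψ hX) = 1 ∨ finrank ℚ (centerField Ψ hX) = finrank ℂ E :=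
  (Nat.dvd_prime hp).1 hX.finrank_centerField_dvd_of_isTotallyReal

/-- **CM centre, odd prime dimension: `e ∈ {2, 2p}`** (`e ∣ 2p`, `e` even: types IV(1,·), IV(p,·)). [cite: Lange2023AbelianVarietiesComplex, §2.6.1 Proposition (table, type IV)] [cite: Gordon1997, 1.13.3] -/
theorem IsSimple.finrank_centerField_eq_two_or_eq_two_mul_of_prime (hX : IsSimple Ψ) [IsCMField (centerField Ψ hX)]
    (hp : (finrank ℂ E).Prime) (hodd : Odd (finrank ℂ E)) :
    finrank ℚ (centerField Ψ hX) = 2 ∨ finrank ℚ (centerField Ψ hX) = 2 * finrank ℂ E := by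
  have hdvd := hX.finrank_centerField_mul_finrank_dvd
  rw [hX.finrank_centerField_endAlgRat_eq_one_of_prime hp hodd, mul_one] at hdvd
  have heven : finrank ℚ (centerField Ψ hX) = 2 * InfinitePlace.nrComplexPlaces (centerField Ψ hX) :=
    IsTotallyComplex.finrank (centerField Ψ hX)
  rw [heven] at hdvd ⊢
  have h' : InfinitePlace.nrComplexPlaces (centerField Ψ hX) ∣ finrank ℂ E := Nat.dvd_of_mul_dvd_mul_left (by norm_num) hdvd
  rcases (Nat.dvd_prime hp).1 h' with h | h
  · exact Or.inl (by rw [h])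
  · exact Or.inr (by rw [h])

/-- **THE FOUR CASES IN ODD PRIME DIMENSION `p`: `e ∈ {1, p}` with `F` totally real (I(1), I(p)) or `e ∈ {2, 2p}` with `F` a CM field
(IV(1,·), IV(p,·))** («either of Type I(1) … or of Type I(g) … or `X` is of CM type, or `End⁰(X)` is an imaginary quadratic field»).
[cite: MoonenZarhin1999LowDim, §2 (p0006 L2–L8)] [cite: Gordon1997, 1.13.3] [cite: Lange2023AbelianVarietiesComplex, §2.6.1 Proposition] -/
theorem IsSimple.finrank_centerField_mem_of_prime (hX : IsSimple Ψ) (hη : IsRiemannForm Ψ η) (hp : (finrank ℂ E).Prime)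
    (hodd : Odd (finrank ℂ E)) :
    (IsTotallyReal (centerField Ψ hX) ∧ (finrank ℚ (centerField Ψ hX) = 1 ∨ finrank ℚ (centerField Ψ hX) = finrank ℂ E)) ∨
      (IsCMField (centerField Ψ hX) ∧ (finrank ℚ (centerField Ψ hX) = 2 ∨ finrank ℚ (centerField Ψ hX) = 2 * finrank ℂ E)) := by
  rcases hX.centerField_isTotallyReal_or_isCMField hη with hR | hCM
  · haveI := hR
    exact Or.inl ⟨hR, hX.finrank_centerField_eq_one_or_eq_of_isTotallyReal_of_prime hp⟩
  · haveI := hCM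
    exact Or.inr ⟨hCM, hX.finrank_centerField_eq_two_or_eq_two_mul_of_prime hp hodd⟩

/-- **TYPE IV(p,·) IS OF CM TYPE: `MT(X)(ℂ)` is a torus** when the centre (`= End⁰(X)`) has degree `2p = 2g`. [cite: Gordon1997, 1.13.3 and 2.12]
[cite: MoonenZarhin1999LowDim, §2 Prop. (2.4) (2)] -/
theorem IsSimple.isTorusSubgroup_mumfordTateGroupC_of_finrank_centerField_eq_two_mul_of_prime (hX : IsSimple Ψ)
    (hp : (finrank ℂ E).Prime) (hodd : Odd (finrank ℂ E)) (he : finrank ℚ (centerField Ψ hX) = 2 * finrank ℂ E) :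
    IsTorusSubgroup (mumfordTateGroupC Ψ) := by
  have hfE := hX.range_valAlgHom_eq_endAlgRat_of_prime hp hodd
  set f := centerField.valAlgHom Ψ hX with hf
  haveI : IsReduced ↥f.range :=
    isReduced_of_injective (AlgEquiv.ofInjectiveField f).symm (AlgEquiv.ofInjectiveField f).symm.injective
  refine isTorusSubgroup_mumfordTateGroupC_of_le_endAlgRat Ψ f.range hfE.le ?_ ?_
  · rintro _ ⟨x, rfl⟩ _ ⟨y, rfl⟩
    rw [← map_mul, ← map_mul, mul_comm]
  · rw [← (AlgEquiv.ofInjectiveField f).toLinearEquiv.finrank_eq, he, card_eq_two_mul_finrank Ψ]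

/-- **MULTIPLICITIES FOR TYPE IV(1,·) IN ODD PRIME DIMENSION: `n_σ + n_σ̄ = p`, `1 ≤ n_σ ≤ p − 1`** (every pair `(n′, p − n′)` is coprime:
«`A` is of Ribet type»). [cite: MoonenZarhin1999LowDim, §1 (p0004 L95–L104) and §2 (p0006 L6–L8)] [cite: Gordon1997, 1.13.2] [cite: Shimura1963AnalyticFamilies, §4 Prop. 14] -/
theorem IsSimple.finrank_iInf_eigenspace_mem_of_finrank_eq_two_of_prime (hX : IsSimple Ψ)
    {K : Type} [Field K] [NumberField K] (f : K →ₐ[ℚ] Matrix κ κ ℚ) (hf : ∀ x, f x ∈ endAlgRat Ψ)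
    (hK : finrank ℚ K = 2) (hp : (finrank ℂ E).Prime) (hodd : Odd (finrank ℂ E)) (σ : K →+* ℂ) :
    finrank ℂ ↥(⨅ y : K, Module.End.eigenspace ((analyticRepHom Ψ ⟨f y, hf y⟩ : E →L[ℂ] E) : E →ₗ[ℂ] E) (σ y)) +
        finrank ℂ ↥(⨅ y : K, Module.End.eigenspace ((analyticRepHom Ψ ⟨f y, hf y⟩ : E →L[ℂ] E) : E →ₗ[ℂ] E)
          (ComplexEmbedding.conjugate σ y)) = finrank ℂ E ∧
      1 ≤ finrank ℂ ↥(⨅ y : K, Module.End.eigenspace ((analyticRepHom Ψ ⟨f y, hf y⟩ : E →L[ℂ] E) : E →ₗ[ℂ] E) (σ y)) ∧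
      finrank ℂ ↥(⨅ y : K, Module.End.eigenspace ((analyticRepHom Ψ ⟨f y, hf y⟩ : E →L[ℂ] E) : E →ₗ[ℂ] E) (σ y)) ≤
        finrank ℂ E - 1 := by
  have h3 : 3 ≤ finrank ℂ E := by
    have h2 := hp.two_le
    obtain ⟨m, hm⟩ := hodd
    omega
  have hcard : 2 < Fintype.card κ := by rw [card_eq_two_mul_finrank Ψ]; omega
  have hsum := finrank_iInf_eigenspace_analyticRepHom_add_conjugate_mul_finrank Ψ f hf σ
  rw [hK, card_eq_two_mul_finrank Ψ] at hsum
  have h1 := hX.finrank_iInf_eigenspace_ne_zero_of_finrank_eq_two Ψ f hf hK hcard σ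
  have h2 := hX.finrank_iInf_eigenspace_ne_zero_of_finrank_eq_two Ψ f hf hK hcard (ComplexEmbedding.conjugate σ)
  omega

end EndField

/-! ## §2 MZ99 Thm. (2.7) in the types I(p), IV(p,·), and IV(1) with a multiplicity `≤ 3`, for every odd prime `p` -/

section Cases

variable {κ : Type} [Fintype κ] [DecidableEq κ] [Nonempty κ] {E : Type} [NormedAddCommGroup E] [NormedSpace ℂ E]
  [FiniteDimensional ℂ E] {Ψ : (κ → ℝ) ≃L[ℝ] E} {η : E [⋀^Fin 2]→L[ℝ] ℝ}

/-- **IV(1) IN ODD PRIME DIMENSION WITH A MULTIPLICITY `≤ 3`: `ℬ•(Xᵏ) = 𝒟•(Xᵏ)` for all `k, p`** — `End⁰(X) = f(K)` imaginary quadratic,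
`g = p` an odd prime, `σ : K ↪ ℂ` with `n_σ ≤ 3` or `n_σ̄ ≤ 3`: `n = 1` ✔ gen-56 (Kostant), `n = 2` ✔ g58-#6 (`(2, odd)`), `n = 3` ✔ g58-#6
(`(3, b)`, `3 ∤ b` as `p ≠ 3` — and `p = 3` forces `n ≤ 2`). [cite: Ribet1983, Thm. 3] [cite: MoonenZarhin1999LowDim, §2 (p0006 L6–L8) and Thm. (2.7)]
[cite: Gordon1997, 1.13.2 and Thm. 6.3 (3)] -/
theorem IsRiemannForm.forall_divisorClasses_powPeriod_eq_hodgeClasses_of_finrank_eq_two_of_prime_of_le_three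
    (hη : IsRiemannForm Ψ η) (hX : IsSimple Ψ) {K : Type} [Field K] [NumberField K] [IsCMField K] (hK : finrank ℚ K = 2)
    (hp : (finrank ℂ E).Prime) (hodd : Odd (finrank ℂ E)) (f : K →ₐ[ℚ] Matrix κ κ ℚ) (hfE : f.range = endAlgRat Ψ)
    (hf : ∀ y, f y ∈ endAlgRat Ψ) (σ : K →+* ℂ)
    (h3 : finrank ℂ ↥(⨅ y : K, Module.End.eigenspace ((analyticRepHom Ψ ⟨f y, hf y⟩ : E →L[ℂ] E) : E →ₗ[ℂ] E) (σ y)) ≤ 3 ∨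
      finrank ℂ ↥(⨅ y : K, Module.End.eigenspace ((analyticRepHom Ψ ⟨f y, hf y⟩ : E →L[ℂ] E) : E →ₗ[ℂ] E)
        (ComplexEmbedding.conjugate σ y)) ≤ 3) :
    ∀ k p : ℕ, divisorClasses (powPeriod Ψ k) p = hodgeClasses (powPeriod Ψ k) p := by
  obtain ⟨hsum, h1, hle⟩ := hX.finrank_iInf_eigenspace_mem_of_finrank_eq_two_of_prime f hf hK hp hodd σ
  obtain ⟨-, h1', hle'⟩ := hX.finrank_iInf_eigenspace_mem_of_finrank_eq_two_of_prime f hf hK hp hodd (ComplexEmbedding.conjugate σ)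
  have hg2 : finrank ℂ E ≠ 2 := fun h ↦ by
    rw [h] at hodd
    exact (Nat.not_odd_iff_even.2 (by decide)) hodd
  -- the three small multiplicities, at any embedding `τ`
  have key : ∀ τ : K →+* ℂ,
      1 ≤ finrank ℂ ↥(⨅ y : K, Module.End.eigenspace ((analyticRepHom Ψ ⟨f y, hf y⟩ : E →L[ℂ] E) : E →ₗ[ℂ] E) (τ y)) →
      finrank ℂ ↥(⨅ y : K, Module.End.eigenspace ((analyticRepHom Ψ ⟨f y, hf y⟩ : E →L[ℂ] E) : E →ₗ[ℂ] E) (τ y)) ≤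
        finrank ℂ E - 1 →
      finrank ℂ ↥(⨅ y : K, Module.End.eigenspace ((analyticRepHom Ψ ⟨f y, hf y⟩ : E →L[ℂ] E) : E →ₗ[ℂ] E) (τ y)) ≤ 3 →
      ∀ k p : ℕ, divisorClasses (powPeriod Ψ k) p = hodgeClasses (powPeriod Ψ k) p := by
    intro τ hτ1 hτle hτ3
    haveI : HodgeTensorFacts.{0, 0} := hodgeTensorFacts_holds.{0, 0}
    by_cases hn1 : finrank ℂ ↥(⨅ y : K, Module.End.eigenspace ((analyticRepHom Ψ ⟨f y, hf y⟩ : E →L[ℂ] E) : E →ₗ[ℂ] E) (τ y)) = 1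
    · exact hη.forall_divisorClasses_powPeriod_eq_hodgeClasses_of_finrank_eq_two_of_finrank_iInf_eigenspace_analyticRepHom_eq_one
        hK hg2 f hfE hf τ hn1
    by_cases hn2 : finrank ℂ ↥(⨅ y : K, Module.End.eigenspace ((analyticRepHom Ψ ⟨f y, hf y⟩ : E →L[ℂ] E) : E →ₗ[ℂ] E) (τ y)) = 2
    · exact hη.forall_divisorClasses_powPeriod_eq_hodgeClasses_of_odd_of_finrank_iInf_eigenspace_analyticRepHom_eq_two
        hK hodd f hfE hf τ hn2
    have hn3 : finrank ℂ ↥(⨅ y : K, Module.End.eigenspace ((analyticRepHom Ψ ⟨f y, hf y⟩ : E →L[ℂ] E) : E →ₗ[ℂ] E) (τ y)) = 3 := by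
      omega
    have hp3 : ¬ 3 ∣ finrank ℂ E := by
      intro h3dvd
      have := (Nat.dvd_prime hp).1 h3dvd
      omega
    exact hη.forall_divisorClasses_powPeriod_eq_hodgeClasses_of_not_three_dvd_of_finrank_iInf_eigenspace_analyticRepHom_eq_three
      hK hp3 f hfE hf τ hn3
  rcases h3 with h | h
  · exact key σ h1 hle h
  · exact key (ComplexEmbedding.conjugate σ) h1' hle' h

/-- **MOONEN–ZARHIN THM. (2.7) FOR EVERY ODD PRIME `p`, OUTSIDE TYPE I(1) AND THE LARGE RIBET SIGNATURES**: a SIMPLE polarised complex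
abelian variety of odd prime dimension `p` with `End⁰(X) ≠ ℚ` whose imaginary-quadratic signature (if `End⁰(X)` is imaginary quadratic)
has a part `≤ 3` satisfies `ℬ•(Xᵏ) = 𝒟•(Xᵏ)` for all `k, p` — types I(p) (maximal real multiplication, Ribet's Thm. 1: g50),
IV(p,·) (simple CM type of prime dimension is nondegenerate: Yanai ∕ the tree's structure-free prime theorem), IV(1) (previous
theorem).  -- TODO(general form): type I(1) for `p ≥ 11` and the signatures with both parts `≥ 4`.
[cite: MoonenZarhin1999LowDim, Thm. (2.7) (p0006 L9–L11)] [cite: Gordon1997, Thm. 6.3 and Corollary] [cite: Ribet1983, Thms. 1–3] [cite: Yanai1985, §4 Theorem (p. 171)] -/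
theorem IsSimple.forall_divisorClasses_powPeriod_eq_hodgeClasses_of_prime_of_finrank_centerField_ne_one (hX : IsSimple Ψ)
    (hη : IsRiemannForm Ψ η) (hp : (finrank ℂ E).Prime) (hodd : Odd (finrank ℂ E)) (he1 : finrank ℚ (centerField Ψ hX) ≠ 1)
    (hsig : finrank ℚ (centerField Ψ hX) = 2 → ∃ σ : centerField Ψ hX →+* ℂ,
      finrank ℂ ↥(⨅ y : centerField Ψ hX, Module.End.eigenspace
        ((analyticRepHom Ψ ⟨centerField.valAlgHom Ψ hX y, centerField.val_mem Ψ hX y⟩ : E →L[ℂ] E) : E →ₗ[ℂ] E) (σ y)) ≤ 3) :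
    ∀ k p : ℕ, divisorClasses (powPeriod Ψ k) p = hodgeClasses (powPeriod Ψ k) p := by
  haveI : HodgeTensorFacts.{0, 0} := hodgeTensorFacts_holds.{0, 0}
  rcases hX.finrank_centerField_mem_of_prime hη hp hodd with ⟨hR, he | he⟩ | ⟨hCM, he | he⟩
  · exact absurd he he1
  · -- I(p): maximal real multiplication
    haveI := hR
    exact hX.forall_divisorClasses_powPeriod_eq_hodgeClasses_of_finrank_centerField_eq hη he
  · -- IV(1): Ribet type with a small multiplicity
    haveI := hCM
    obtain ⟨σ, hσ⟩ := hsig he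
    exact hη.forall_divisorClasses_powPeriod_eq_hodgeClasses_of_finrank_eq_two_of_prime_of_le_three hX he hp hodd
      (centerField.valAlgHom Ψ hX) (hX.range_valAlgHom_eq_endAlgRat_of_prime hp hodd) (centerField.val_mem Ψ hX) σ (Or.inl hσ)
  · -- IV(p,·): CM type, prime dimension
    have hcard : Fintype.card κ = 2 * finrank ℂ E := card_eq_two_mul_finrank Ψ
    have hA : IsAbelianVariety Ψ := ⟨η, hη⟩
    exact fun k p ↦ hA.divisorClasses_powPeriod_eq_hodgeClasses_of_isSimple_of_card_eq_two_mul_prime_of_isTorusSubgroup_mumfordTateGroupC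
      hX (hX.isTorusSubgroup_mumfordTateGroupC_of_finrank_centerField_eq_two_mul_of_prime hp hodd he) hp hcard k p

/-- **TYPE IV(p,·) (SIMPLE, CM TYPE, ODD PRIME DIMENSION) IS STABLY NONDEGENERATE**, hypothesis on the centre only.
[cite: Yanai1985, §4 Theorem (p. 171)] [cite: Gordon1997, Thm. 6.4 and 1.13.3] [cite: MoonenZarhin1999LowDim, Thm. (2.7)] -/
theorem IsSimple.forall_divisorClasses_powPeriod_eq_hodgeClasses_of_prime_of_finrank_centerField_eq_two_mul (hX : IsSimple Ψ)
    (hη : IsRiemannForm Ψ η) (hp : (finrank ℂ E).Prime) (hodd : Odd (finrank ℂ E))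
    (he : finrank ℚ (centerField Ψ hX) = 2 * finrank ℂ E) :
    ∀ k p : ℕ, divisorClasses (powPeriod Ψ k) p = hodgeClasses (powPeriod Ψ k) p := by
  have h2 := hp.two_le
  refine hX.forall_divisorClasses_powPeriod_eq_hodgeClasses_of_prime_of_finrank_centerField_ne_one hη hp hodd (by omega) fun h ↦ ?_
  omega

/-- **`Hg(X) = Sp_D(V,φ)`** (real points `Hg(X)(ℝ) = S(X)(ℝ)`) in the same cases. [cite: MoonenZarhin1999LowDim, Thm. (2.7)] [cite: Milne1999LefschetzClasses, §4 Prop. 4.8] -/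
theorem IsSimple.hodgeGroup_eq_lefschetzGroup_of_prime_of_finrank_centerField_ne_one (hX : IsSimple Ψ)
    (hη : IsRiemannForm Ψ η) (hp : (finrank ℂ E).Prime) (hodd : Odd (finrank ℂ E)) (he1 : finrank ℚ (centerField Ψ hX) ≠ 1)
    (hsig : finrank ℚ (centerField Ψ hX) = 2 → ∃ σ : centerField Ψ hX →+* ℂ,
      finrank ℂ ↥(⨅ y : centerField Ψ hX, Module.End.eigenspace
        ((analyticRepHom Ψ ⟨centerField.valAlgHom Ψ hX y, centerField.val_mem Ψ hX y⟩ : E →L[ℂ] E) : E →ₗ[ℂ] E) (σ y)) ≤ 3) :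
    hodgeGroup Ψ = lefschetzGroup Ψ η := by
  obtain ⟨G, hG⟩ := hη.exists_ratMatrix_latticeGram
  exact ((hη.forall_divisorClasses_powPeriod_eq_hodgeClasses_iff_eq_and_hodgeGroup_eq_lefschetzGroup hG hp.pos).1
    (hX.forall_divisorClasses_powPeriod_eq_hodgeClasses_of_prime_of_finrank_centerField_ne_one hη hp hodd he1 hsig)).2

/-! ### The Hodge-group dimensions in the three settled types -/

/-- **IV(p,·): `dim Hg(X) = p`** (the CM type of a simple CM abelian variety of odd prime dimension is nondegenerate: Hazama ∕ Gordon 6.4).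
[cite: Gordon1997, Thm. 6.4] [cite: Yanai1985, §4 Theorem] [cite: MoonenZarhin1999LowDim, §2 Prop. (2.5) (2)] -/
theorem IsSimple.finrank_hodgeGroupLie_eq_of_prime_of_finrank_centerField_eq_two_mul (hX : IsSimple Ψ) (hη : IsRiemannForm Ψ η)
    (hp : (finrank ℂ E).Prime) (hodd : Odd (finrank ℂ E)) (he : finrank ℚ (centerField Ψ hX) = 2 * finrank ℂ E) :
    finrank ℝ (hodgeGroupLie Ψ) = finrank ℂ E := by
  rcases hX.centerField_isTotallyReal_or_isCMField hη with hR | hCM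
  · haveI := hR
    have h2 := hp.two_le
    rcases hX.finrank_centerField_eq_one_or_eq_of_isTotallyReal_of_prime hp with h | h <;> omega
  · haveI := hCM
    have hdim : finrank ℚ (endAlgRat Ψ) = Fintype.card κ := by
      rw [← hX.range_valAlgHom_eq_endAlgRat_of_prime hp hodd,
        ← (AlgEquiv.ofInjectiveField (centerField.valAlgHom Ψ hX)).toLinearEquiv.finrank_eq, he, card_eq_two_mul_finrank Ψ]
    exact (hX.forall_divisorClasses_powPeriod_eq_hodgeClasses_iff_finrank_hodgeGroupLie_eq_finrank_of_isCMField_of_endAlgRat_comm hη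
      (hX.endAlgRat_comm_of_prime hp hodd) hdim).1
      (hX.forall_divisorClasses_powPeriod_eq_hodgeClasses_of_prime_of_finrank_centerField_eq_two_mul hη hp hodd he)

/-- **I(p): `dim Hg(X) = 3p`** (maximal real multiplication, `Hg = R_{F/ℚ} SL₂`). [cite: Gordon1997, Thm. 6.3 (sketch)] [cite: MoonenZarhin1999LowDim, §2 (2.3) Type I(g)] -/
theorem IsSimple.finrank_hodgeGroupLie_eq_three_mul_of_prime_of_finrank_centerField_eq (hX : IsSimple Ψ) (hη : IsRiemannForm Ψ η)
    (hp : (finrank ℂ E).Prime) (hodd : Odd (finrank ℂ E)) (he : finrank ℚ (centerField Ψ hX) = finrank ℂ E) :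
    finrank ℝ (hodgeGroupLie Ψ) = 3 * finrank ℂ E := by
  rcases hX.centerField_isTotallyReal_or_isCMField hη with hR | hCM
  · haveI := hR
    exact hX.finrank_hodgeGroupLie_eq_three_mul_of_finrank_centerField_eq hη he
  · haveI := hCM
    have h2 := hp.two_le
    rcases hX.finrank_centerField_eq_two_or_eq_two_mul_of_prime hp hodd with h | h
    · exfalso
      rw [he] at h
      rw [h] at hodd
      exact (Nat.not_odd_iff_even.2 (by decide)) hodd
    · omega

/-- **IV(1) WITH A MULTIPLICITY `≤ 3`: `dim Hg(X) = p²`** (`Hg = U_K(V,ψ)`, ✔ g58-#9 `dim U_K(V,ψ) = g²`). [cite: Ribet1983, Thm. 3] [cite: Milne1999LefschetzClasses, §2 Summary table (p. 652)] -/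
theorem IsSimple.finrank_hodgeGroupLie_eq_sq_of_prime_of_finrank_centerField_eq_two (hX : IsSimple Ψ) (hη : IsRiemannForm Ψ η)
    (hp : (finrank ℂ E).Prime) (hodd : Odd (finrank ℂ E)) (he : finrank ℚ (centerField Ψ hX) = 2)
    (hsig : ∃ σ : centerField Ψ hX →+* ℂ,
      finrank ℂ ↥(⨅ y : centerField Ψ hX, Module.End.eigenspace
        ((analyticRepHom Ψ ⟨centerField.valAlgHom Ψ hX y, centerField.val_mem Ψ hX y⟩ : E →L[ℂ] E) : E →ₗ[ℂ] E) (σ y)) ≤ 3) :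
    finrank ℝ (hodgeGroupLie Ψ) = finrank ℂ E ^ 2 := by
  rcases hX.centerField_isTotallyReal_or_isCMField hη with hR | hCM
  · haveI := hR
    have h2 := hp.two_le
    rcases hX.finrank_centerField_eq_one_or_eq_of_isTotallyReal_of_prime hp with h | h
    · omega
    · exfalso
      rw [he] at h
      rw [← h] at hodd
      exact (Nat.not_odd_iff_even.2 (by decide)) hodd
  · haveI := hCM
    have h2 := hp.two_le
    exact hη.finrank_hodgeGroupLie_eq_sq_of_forall_divisorClasses_powPeriod_eq_hodgeClasses he (centerField.valAlgHom Ψ hX)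
      (hX.range_valAlgHom_eq_endAlgRat_of_prime hp hodd)
      (hX.forall_divisorClasses_powPeriod_eq_hodgeClasses_of_prime_of_finrank_centerField_ne_one hη hp hodd (by omega) fun _ ↦ hsig)

end Cases

end ComplexTorus

end Literature.Geometry.Kaehler

end
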